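import Mathlib
import HarnessLib
import Literature.MathematicalPhysics.StatisticalMechanics.LennardJonesClusters
import Literature.MathematicalPhysics.StatisticalMechanics.PeriodicConfigurationSums

/-!
# `TorusDefectGap` — BC2 redirect: split assembly (crux-strategist, 2026-08-17)

Route `FlatToriSuffice`, deciding crux `TorusDefectGap` (item `stmt-AtomisticToContinuum-11950`):
`∃ P₀ ∀ R ε > 0 ∃ g > 0 ∀ periodic P, g · #bad_(R,ε)(P; P₀) ≤ #motif · (e(P) − e(P₀))`.
The route re-audit binned it RESTATED (summit-or-harder). This file is the PROVED assembly of the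
redirecting decomposition, cut along the SCALE seam (the route's own two-layer plan (a)):

  `TorusDefectGap ⟸ CrysPeriodicMinAttained ∧ TwoShellDefectGap ∧ TwoShellLocalRules ∧ PricedClosePairs`

* `CrysPeriodicMinAttained` (E, item 0627, existing rank-4 crux): a periodic minimiser `P₀` exists.
* `TwoShellDefectGap` (T, item 11952, existing rank-3 crux): at every periodic minimiser the defect
  gap holds AT THE FIXED SCALE `R = 2` for every tolerance `η`.
* `TwoShellLocalRules` (L, NEW crux, item 17669, rank 5): ROBUST TWO-SHELL LOCAL RULES — for every minimiser `P₀` and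
  target `(R, ε)` there are `η, L > 0` such that, in ANY periodic `P`, a point all of whose
  `L`-neighbours are `(2, η)`-good is itself `(R, ε)`-good (Delone/Dolbilin local theory, robust form).
* `PricedClosePairs` (C, NEW support, item 17670): at every minimiser, points with another point within `r`
  are priced linearly: `c · #D_r(P) ≤ #motif · (e(P) − e(P₀))` for some `r, c > 0`
  (surgery at chemical potential `e(P₀)` + stability; provable).

**Assembly** `torusDefectGap_of_pieces` (≈ 120 tactic lines, no sorry, axioms propext /
Classical.choice / Quot.sound): fix `P₀` from E; given `(R, ε)` take `(η, L)` from L, `g₂` from T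
at tolerance `η`, `(r, c)` from C, and put `g := (1/c + (2L/r + 1)³/g₂)⁻¹`. For a periodic `P`
split the `(R, ε)`-bad motif points into those in `D_r` (priced by C) and the `r`-isolated ones;
an isolated bad `x` has, by L (contrapositive), a `(2, η)`-bad point `y ∈ P.points` within `L`,
whose motif representative `m` is `(2, η)`-bad as well (`good_add_of_mem_lattice`: goodness is
invariant under the lattice of periods). Charging `x ↦ m`, the fibre over `m` injects
(`x ↦ x − y_x + m`; motif points are inequivalent mod the lattice) into an `r`-separated subset of
`P.points ∩ B̄(m, L)`, so it has at most `(2L/r + 1)³` elements by the tree's packing lemma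
`card_le_of_separated_of_dist_le` (`card_fibre_le`). Hence
`#bad_(R,ε) ≤ #D_r + (2L/r + 1)³ · #bad_(2,η)` (`card_bad_le`), and T, C close the estimate
(`gap_arith`). The seam carries the whole passage between scales; no piece gives `TorusDefectGap`
(or the Statement) on its own (probes `first | exact? | simpa | aesop` fail 8/8).

The `def`s `TwoShellLocalRules`, `PricedClosePairs` below are VERBATIM (modulo the abbreviation
`Good`, definitionally unfolded in `torusDefectGap_of_pieces`) the statements filed as the route
items stmt-17669 / stmt-17670 of `Theses/FlatToriSuffice.lean` (rev 4), and the glue item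
`TorusDefectGapSplitGlue` (stmt-17671) is `CrysPeriodicMinAttained → TwoShellDefectGap →
TwoShellLocalRules → PricedClosePairs → TorusDefectGap`; since every constant involved is a plain
`def` with the same body here and there, `theorem … : TorusDefectGapSplitGlue :=
Summit.AtomisticToContinuum.Crystallization.Cruxes.TorusDefectGap.Split.torusDefectGap_of_pieces`
typechecks by unfolding (this file imports no Theses file: no cycle). The deciding theorem of the
route (rev 4) takes the four pieces and the glue as binders and derives `TorusDefectGap` inside.
-/

noncomputable section

open scoped BigOperators Classical
open Set Metric

namespace Summit.AtomisticToContinuum.Crystallization.Cruxes.TorusDefectGap.Split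

open Literature.MathematicalPhysics.StatisticalMechanics

local notation "E3" => EuclideanSpace ℝ (Fin 3)
local notation "PC" => Literature.MathematicalPhysics.StatisticalMechanics.PeriodicConfiguration 3

/-! ## The parent and the two existing pieces (VERBATIM copies of the route decls)

This workfile does not import `Theses/FlatToriSuffice.lean` (so that the route file may import
it without a cycle); the three `def`s below are byte-identical to the route's
`TorusDefectGap` (stmt-11950), `TwoShellDefectGap` (stmt-11952), `CrysPeriodicMinAttained`
(stmt-0627), hence definitionally equal to them. -/

/-- VERBATIM `Summit.AtomisticToContinuum.Crystallization.Theses.FlatToriSuffice.TorusDefectGap`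
(item stmt-AtomisticToContinuum-11950, the parent). -/
def TorusDefectGap : Prop :=
  ∃ P₀ : Literature.MathematicalPhysics.StatisticalMechanics.PeriodicConfiguration 3, ∀ R ε : ℝ, 0 < R → 0 < ε → ∃ g : ℝ, 0 < g ∧ ∀ P : Literature.MathematicalPhysics.StatisticalMechanics.PeriodicConfiguration 3, g * ({x : EuclideanSpace ℝ (Fin 3) | x ∈ P.motif ∧ ¬ (∃ p₀ ∈ P₀.motif, ∃ A : EuclideanSpace ℝ (Fin 3) ≃ₗᵢ[ℝ] EuclideanSpace ℝ (Fin 3), (∀ p ∈ P₀.points, dist p p₀ ≤ R → ∃ y ∈ P.points, dist y (x + A (p - p₀)) ≤ ε) ∧ (∀ y ∈ P.points, dist y x ≤ R → ∃ p ∈ P₀.points, dist y (x + A (p - p₀)) ≤ ε))}.ncard : ℝ) ≤ (P.motif.card : ℝ) * (P.energyPerParticle Literature.MathematicalPhysics.StatisticalMechanics.lennardJones - P₀.energyPerParticle Literature.MathematicalPhysics.StatisticalMechanics.lennardJones)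

/-- VERBATIM `…Theses.FlatToriSuffice.TwoShellDefectGap` (item stmt-AtomisticToContinuum-11952, piece T). -/
def TwoShellDefectGap : Prop :=
  ∀ P₀ : Literature.MathematicalPhysics.StatisticalMechanics.PeriodicConfiguration 3, IsLeast (Set.range fun Q : Literature.MathematicalPhysics.StatisticalMechanics.PeriodicConfiguration 3 => Q.energyPerParticle Literature.MathematicalPhysics.StatisticalMechanics.lennardJones) (P₀.energyPerParticle Literature.MathematicalPhysics.StatisticalMechanics.lennardJones) → ∀ ε : ℝ, 0 < ε → ∃ g : ℝ, 0 < g ∧ ∀ P : Literature.MathematicalPhysics.StatisticalMechanics.PeriodicConfiguration 3, g * ({x : EuclideanSpace ℝ (Fin 3) | x ∈ P.motif ∧ ¬ (∃ p₀ ∈ P₀.motif, ∃ A : EuclideanSpace ℝ (Fin 3) ≃ₗᵢ[ℝ] EuclideanSpace ℝ (Fin 3), (∀ p ∈ P₀.points, dist p p₀ ≤ (2 : ℝ) → ∃ y ∈ P.points, dist y (x + A (p - p₀)) ≤ ε) ∧ (∀ y ∈ P.points, dist y x ≤ (2 : ℝ) → ∃ p ∈ P₀.points, dist y (x + A (p -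 p₀)) ≤ ε))}.ncard : ℝ) ≤ (P.motif.card : ℝ) * (P.energyPerParticle Literature.MathematicalPhysics.StatisticalMechanics.lennardJones - P₀.energyPerParticle Literature.MathematicalPhysics.StatisticalMechanics.lennardJones)

/-- VERBATIM `…Theses.FlatToriSuffice.CrysPeriodicMinAttained` (item stmt-AtomisticToContinuum-0627, piece E). -/
def CrysPeriodicMinAttained : Prop :=
  ∃ P : Literature.MathematicalPhysics.StatisticalMechanics.PeriodicConfiguration 3, IsLeast (Set.range fun Q : Literature.MathematicalPhysics.StatisticalMechanics.PeriodicConfiguration 3 => Q.energyPerParticle Literature.MathematicalPhysics.StatisticalMechanics.lennardJones) (P.energyPerParticle Literature.MathematicalPhysics.StatisticalMechanics.lennardJones)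

/-- `(R, ε)`-goodness of a point `x` of `P` relative to the reference configuration `P₀`: the
radius-`R` environment of `x` in `P.points` is `ε`-matched both ways, after a linear isometry `A`,
to the environment of some motif site `p₀` of `P₀` (the matching clauses of `TorusDefectGap`). -/
def Good (P₀ P : PC) (R ε : ℝ) (x : E3) : Prop :=
  ∃ p₀ ∈ P₀.motif, ∃ A : E3 ≃ₗᵢ[ℝ] E3,
    (∀ p ∈ P₀.points, dist p p₀ ≤ R → ∃ y ∈ P.points, dist y (x + A (p - p₀)) ≤ ε) ∧
    (∀ y ∈ P.points, dist y x ≤ R → ∃ p ∈ P₀.points, dist y (x + A (p - p₀)) ≤ ε)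

/-- `P₀` minimises the Lennard-Jones energy per particle among periodic configurations. -/
def IsMin (P₀ : PC) : Prop :=
  IsLeast (Set.range fun Q : PC => Q.energyPerParticle lennardJones)
    (P₀.energyPerParticle lennardJones)

/-- Piece L — ROBUST TWO-SHELL LOCAL RULES at every periodic minimiser. -/
def TwoShellLocalRules : Prop :=
  ∀ P₀ : PC, IsMin P₀ → ∀ R ε : ℝ, 0 < R → 0 < ε → ∃ η L : ℝ, 0 < η ∧ 0 < L ∧
    ∀ P : PC, ∀ x ∈ P.points,
      (∀ y ∈ P.points, dist y x ≤ L → Good P₀ P 2 η y) → Good P₀ P R ε x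

/-- Piece C — PRICED CLOSE PAIRS at every periodic minimiser. -/
def PricedClosePairs : Prop :=
  ∀ P₀ : PC, IsMin P₀ → ∃ r c : ℝ, 0 < r ∧ 0 < c ∧ ∀ P : PC,
    c * ({x : E3 | x ∈ P.motif ∧ ∃ z ∈ P.points, z ≠ x ∧ dist z x < r}.ncard : ℝ)
      ≤ (P.motif.card : ℝ) *
        (P.energyPerParticle lennardJones - P₀.energyPerParticle lennardJones)

/-! ## Lemmas -/

/-- Goodness is invariant under the lattice of periods of `P`. -/
theorem good_add_of_mem_lattice {P₀ P : PC} {R ε : ℝ} {x g : E3} (hg : g ∈ P.lattice)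
    (h : Good P₀ P R ε x) : Good P₀ P R ε (x + g) := by
  obtain ⟨p₀, hp₀, A, h1, h2⟩ := h
  refine ⟨p₀, hp₀, A, fun p hp hpR => ?_, fun y hy hyR => ?_⟩
  · obtain ⟨y, hy, hyd⟩ := h1 p hp hpR
    refine ⟨y + g, P.add_mem_points hy hg, ?_⟩
    have : x + g + A (p - p₀) = (x + A (p - p₀)) + g := by abel
    rw [this, dist_add_right]
    exact hyd
  · have hy' : y - g ∈ P.points := by
      simpa [sub_eq_add_neg] using P.add_mem_points hy (P.lattice.neg_mem hg)
    have hd : dist (y - g) x ≤ R := by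
      have : dist (y - g) x = dist y (x + g) := by
        rw [dist_eq_norm, dist_eq_norm]; congr 1; abel
      rw [this]; exact hyR
    obtain ⟨p, hp, hpd⟩ := h2 (y - g) hy' hd
    refine ⟨p, hp, ?_⟩
    have : dist y (x + g + A (p - p₀)) = dist (y - g) (x + A (p - p₀)) := by
      rw [dist_eq_norm, dist_eq_norm]; congr 1; abel
    rw [this]; exact hpd

/-- `{x | x ∈ s ∧ q x}.ncard` is the cardinality of the filtered finset. -/
theorem ncard_setOf_mem_and (s : Finset E3) (q : E3 → Prop) [DecidablePred q] :
    {x : E3 | x ∈ s ∧ q x}.ncard = (s.filter q).card := by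
  rw [← Set.ncard_coe_finset]
  congr 1
  ext x
  simp

/-- **Packing bound for one fibre of the charging map.** If every `x ∈ F` is a motif point of `P`
with no other point of `P` within distance `< r`, and has a point `y_x ∈ P.points` within `L`
which is a lattice translate of the fixed point `m`, then `#F ≤ (2L/r + 1)³`: the points
`x - y_x + m` are points of `P` in the ball `B̄(m, L)`, pairwise distinct (motif points are
inequivalent mod the lattice) and `r`-separated (isolation is lattice-invariant). -/
theorem card_fibre_le (P : PC) (m : E3) {r L : ℝ} (hr : 0 < r) (hL : 0 ≤ L)
    (F : Finset E3)
    (hFmotif : ∀ x ∈ F, x ∈ P.motif)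
    (hFiso : ∀ x ∈ F, ∀ z ∈ P.points, z ≠ x → r ≤ dist z x)
    (hFnear : ∀ x ∈ F, ∃ y ∈ P.points, dist y x ≤ L ∧ y - m ∈ P.lattice) :
    (F.card : ℝ) ≤ (2 * L / r + 1) ^ 3 := by
  choose! yf hyP hyd hyl using hFnear
  set φ : E3 → E3 := fun x => x - yf x + m with hφ
  have hφpts : ∀ x ∈ F, φ x ∈ P.points := fun x hx => by
    have : φ x = x + (-(yf x - m)) := by simp only [hφ]; abel
    rw [this]
    exact P.add_mem_points (P.mem_points_of_mem_motif (hFmotif x hx))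
      (P.lattice.neg_mem (hyl x hx))
  have hφdist : ∀ x ∈ F, dist (φ x) m ≤ L := fun x hx => by
    have : dist (φ x) m = dist (yf x) x := by
      simp only [hφ]
      rw [dist_eq_norm, dist_eq_norm, ← norm_neg]
      congr 1
      abel
    rw [this]
    exact hyd x hx
  have hφinj : Set.InjOn φ F := fun x₁ hx₁ x₂ hx₂ heq => by
    have h' : x₁ - yf x₁ = x₂ - yf x₂ := add_right_cancel heq
    have h12 : x₁ - x₂ = (yf x₁ - m) - (yf x₂ - m) := by
      calc x₁ - x₂ = (x₁ - yf x₁) - (x₂ - yf x₂) + (yf x₁ - yf x₂) := by abel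
        _ = (yf x₁ - m) - (yf x₂ - m) := by rw [h']; abel
    apply P.eq_of_sub_mem x₁ (hFmotif x₁ hx₁) x₂ (hFmotif x₂ hx₂)
    rw [h12]
    exact P.lattice.sub_mem (hyl x₁ hx₁) (hyl x₂ hx₂)
  have hsep : ∀ c ∈ F.image φ, ∀ d ∈ F.image φ, c ≠ d → r ≤ dist c d := by
    intro c hc d hd hcd
    obtain ⟨x₁, hx₁, rfl⟩ := Finset.mem_image.1 hc
    obtain ⟨x₂, hx₂, rfl⟩ := Finset.mem_image.1 hd
    set z : E3 := x₂ + (yf x₁ - m - (yf x₂ - m)) with hz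
    have hzP : z ∈ P.points :=
      P.add_mem_points (P.mem_points_of_mem_motif (hFmotif x₂ hx₂))
        (P.lattice.sub_mem (hyl x₁ hx₁) (hyl x₂ hx₂))
    have hdz : dist (φ x₁) (φ x₂) = dist z x₁ := by
      simp only [hφ, hz]
      rw [dist_eq_norm, dist_eq_norm, ← norm_neg]
      congr 1
      abel
    have hzx : z ≠ x₁ := fun h => hcd (by
      have h0 : dist (φ x₁) (φ x₂) = 0 := by rw [hdz, h, dist_self]
      exact dist_eq_zero.1 h0)
    rw [hdz]
    exact hFiso x₁ hx₁ z hzP hzx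
  have hball : ∀ c ∈ F.image φ, dist c m ≤ L := by
    intro c hc
    obtain ⟨x, hx, rfl⟩ := Finset.mem_image.1 hc
    exact hφdist x hx
  have key := card_le_of_separated_of_dist_le (F.image φ) m hr hL hball hsep
  rw [Finset.card_image_of_injOn hφinj, finrank_euclideanSpace_fin] at key
  exact key

/-- **The torus counting argument.** With the robust local rules in force (every point all of
whose `L`-neighbours are `(2, η)`-good is `(R, ε)`-good), the `(R, ε)`-bad motif points of `P`
number at most `#D + (2L/r + 1)³ · #bad₂`, where `D` is the set of motif points with another
point of `P` within distance `< r` and `bad₂` the set of `(2, η)`-bad motif points: an isolated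
bad point `x` has a `(2, η)`-bad point of `P` within `L`, whose motif representative `m` is bad
too (goodness is lattice-invariant); charging `x` to `m`, each fibre is bounded by the packing
lemma `card_fibre_le`. -/
theorem card_bad_le (P₀ P : PC) {R ε η L r : ℝ} (hr : 0 < r) (hL : 0 < L)
    (hrules : ∀ x ∈ P.points, (∀ y ∈ P.points, dist y x ≤ L → Good P₀ P 2 η y) →
      Good P₀ P R ε x) :
    ({x : E3 | x ∈ P.motif ∧ ¬ Good P₀ P R ε x}.ncard : ℝ) ≤
      {x : E3 | x ∈ P.motif ∧ ∃ z ∈ P.points, z ≠ x ∧ dist z x < r}.ncard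
        + (2 * L / r + 1) ^ 3 * {x : E3 | x ∈ P.motif ∧ ¬ Good P₀ P 2 η x}.ncard := by
  have e1 := ncard_setOf_mem_and P.motif (fun x => ¬ Good P₀ P R ε x)
  have e2 := ncard_setOf_mem_and P.motif (fun x => ¬ Good P₀ P 2 η x)
  have e3 := ncard_setOf_mem_and P.motif (fun x => ∃ z ∈ P.points, z ≠ x ∧ dist z x < r)
  rw [e1, e2, e3]
  set bad := P.motif.filter fun x => ¬ Good P₀ P R ε x with hbad
  set D := P.motif.filter fun x => ∃ z ∈ P.points, z ≠ x ∧ dist z x < r with hD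
  set bad₂ := P.motif.filter fun x => ¬ Good P₀ P 2 η x with hbad₂
  set K : ℝ := (2 * L / r + 1) ^ 3 with hK
  set S := bad.filter fun x => ¬ ∃ z ∈ P.points, z ≠ x ∧ dist z x < r with hS
  set F : E3 → Finset E3 := fun m =>
    S.filter fun x => ∃ y ∈ P.points, dist y x ≤ L ∧ y - m ∈ P.lattice with hF
  have hsplit : bad.card ≤ D.card + S.card := by
    have hcov : bad ⊆ D ∪ S := by
      intro x hx
      rw [Finset.mem_union]
      by_cases hq : ∃ z ∈ P.points, z ≠ x ∧ dist z x < r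
      · left
        simp only [hbad, hD, Finset.mem_filter] at hx ⊢
        exact ⟨hx.1, hq⟩
      · right
        simp only [hS, Finset.mem_filter]
        exact ⟨hx, hq⟩
    exact (Finset.card_le_card hcov).trans (Finset.card_union_le _ _)
  have hcover : S ⊆ bad₂.biUnion F := by
    intro x hx
    have hxS := hx
    simp only [hS, hbad, Finset.mem_filter] at hx
    obtain ⟨⟨hxm, hxbad⟩, -⟩ := hx
    have hxP : x ∈ P.points := P.mem_points_of_mem_motif hxm
    have h' : ¬ ∀ y ∈ P.points, dist y x ≤ L → Good P₀ P 2 η y :=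
      fun h => hxbad (hrules x hxP h)
    push Not at h'
    obtain ⟨y, hyP, hyd, hybad⟩ := h'
    obtain ⟨m, hm, hym⟩ := P.exists_sub_mem_lattice hyP
    have hmbad : ¬ Good P₀ P 2 η m := fun hgood => hybad (by
      have h'' := good_add_of_mem_lattice hym hgood
      rwa [add_sub_cancel] at h'')
    refine Finset.mem_biUnion.2 ⟨m, ?_, ?_⟩
    · simp only [hbad₂, Finset.mem_filter]
      exact ⟨hm, hmbad⟩
    · simp only [hF, Finset.mem_filter]
      exact ⟨hxS, y, hyP, hyd, hym⟩
  have hfibre : ∀ m ∈ bad₂, ((F m).card : ℝ) ≤ K := by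
    intro m _
    apply card_fibre_le P m hr hL.le (F m)
    · intro x hx
      simp only [hF, hS, hbad, Finset.mem_filter] at hx
      exact hx.1.1.1
    · intro x hx z hz hzx
      simp only [hF, hS, hbad, Finset.mem_filter] at hx
      have hiso := hx.1.2
      by_contra hlt
      push Not at hlt
      exact hiso ⟨z, hz, hzx, hlt⟩
    · intro x hx
      simp only [hF, Finset.mem_filter] at hx
      exact hx.2
  have hScard : (S.card : ℝ) ≤ K * bad₂.card := by
    calc (S.card : ℝ) ≤ ((bad₂.biUnion F).card : ℝ) := by
          exact_mod_cast Finset.card_le_card hcover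
      _ ≤ ∑ m ∈ bad₂, ((F m).card : ℝ) := by
          exact_mod_cast Finset.card_biUnion_le
      _ ≤ ∑ m ∈ bad₂, K := Finset.sum_le_sum hfibre
      _ = K * bad₂.card := by rw [Finset.sum_const, nsmul_eq_mul, mul_comm]
  calc (bad.card : ℝ) ≤ D.card + S.card := by exact_mod_cast hsplit
    _ ≤ D.card + K * bad₂.card := by linarith

/-- The closing real arithmetic: `B ≤ D + K B₂`, `c D ≤ Δ`, `g₂ B₂ ≤ Δ` give
`(c⁻¹ + K g₂⁻¹)⁻¹ B ≤ Δ`. -/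
theorem gap_arith {B B₂ Dn Δ c g₂ K : ℝ} (hc : 0 < c) (hg : 0 < g₂) (hK : 0 ≤ K)
    (h1 : B ≤ Dn + K * B₂) (h2 : c * Dn ≤ Δ) (h3 : g₂ * B₂ ≤ Δ) :
    (c⁻¹ + K * g₂⁻¹)⁻¹ * B ≤ Δ := by
  have hM : 0 < c⁻¹ + K * g₂⁻¹ := by positivity
  have hDn : Dn ≤ Δ / c := by rw [le_div_iff₀ hc]; linarith
  have hB₂ : B₂ ≤ Δ / g₂ := by rw [le_div_iff₀ hg]; linarith
  have hB : B ≤ (c⁻¹ + K * g₂⁻¹) * Δ := by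
    calc B ≤ Dn + K * B₂ := h1
      _ ≤ Δ / c + K * (Δ / g₂) := by gcongr
      _ = (c⁻¹ + K * g₂⁻¹) * Δ := by ring
  calc (c⁻¹ + K * g₂⁻¹)⁻¹ * B ≤ (c⁻¹ + K * g₂⁻¹)⁻¹ * ((c⁻¹ + K * g₂⁻¹) * Δ) := by gcongr
    _ = Δ := by rw [← mul_assoc, inv_mul_cancel₀ hM.ne', one_mul]

/-- **Split assembly** (pieces stated with the abbreviation `Good`). -/
theorem torusDefectGap_of_pieces' (hE : CrysPeriodicMinAttained) (hT : TwoShellDefectGap)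
    (hL : TwoShellLocalRules) (hC : PricedClosePairs) : TorusDefectGap := by
  obtain ⟨P₀, hmin⟩ := hE
  refine ⟨P₀, fun R ε hR hε => ?_⟩
  obtain ⟨η, L, hη, hLpos, hrules⟩ := hL P₀ hmin R ε hR hε
  obtain ⟨g₂, hg₂, hgap₂⟩ := hT P₀ hmin η hη
  obtain ⟨r, c, hr, hc, hclose⟩ := hC P₀ hmin
  have hK : (0 : ℝ) ≤ (2 * L / r + 1) ^ 3 := by positivity
  refine ⟨(c⁻¹ + (2 * L / r + 1) ^ 3 * g₂⁻¹)⁻¹, by positivity, fun P => ?_⟩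
  have h2 : g₂ * ({x : E3 | x ∈ P.motif ∧ ¬ Good P₀ P 2 η x}.ncard : ℝ) ≤
      (P.motif.card : ℝ) *
        (P.energyPerParticle lennardJones - P₀.energyPerParticle lennardJones) := hgap₂ P
  have hD := hclose P
  have hcount := card_bad_le P₀ P (R := R) (ε := ε) hr hLpos (hrules P)
  exact gap_arith hc hg₂ hK hcount hD h2

/-- **Split assembly, route form**: the four pieces, stated VERBATIM as the route items
`CrysPeriodicMinAttained` (stmt-0627), `TwoShellDefectGap` (stmt-11952) and the two new children
`TwoShellLocalRules`, `PricedClosePairs` of `TorusDefectGap` in `Theses/FlatToriSuffice.lean`, imply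
`TorusDefectGap` (stmt-11950). -/
theorem torusDefectGap_of_pieces
    (hE : CrysPeriodicMinAttained) (hT : TwoShellDefectGap)
    (hL : ∀ P₀ : Literature.MathematicalPhysics.StatisticalMechanics.PeriodicConfiguration 3, IsLeast (Set.range fun Q : Literature.MathematicalPhysics.StatisticalMechanics.PeriodicConfiguration 3 => Q.energyPerParticle Literature.MathematicalPhysics.StatisticalMechanics.lennardJones) (P₀.energyPerParticle Literature.MathematicalPhysics.StatisticalMechanics.lennardJones) → ∀ R ε : ℝ, 0 < R → 0 < ε → ∃ η L : ℝ, 0 < η ∧ 0 < L ∧ ∀ P : Literature.MathematicalPhysics.StatisticalMechanics.PeriodicConfiguration 3, ∀ x ∈ P.points, (∀ y ∈ P.points, dist y x ≤ L → ∃ p₀ ∈ P₀.motif, ∃ A : EuclideanSpace ℝ (Fin 3) ≃ₗᵢ[ℝ] EuclideanSpace ℝ (Fin 3), (∀ p ∈ P₀.points, dist p p₀ ≤ (2 : ℝ) → ∃ y' ∈ P.points, dist y' (y + A (p - p₀)) ≤ η) ∧ (∀ y' ∈ P.points, dist y' y ≤ (2 : ℝ) → ∃ p ∈ P₀.points, dist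 y' (y + A (p - p₀)) ≤ η)) → ∃ p₀ ∈ P₀.motif, ∃ A : EuclideanSpace ℝ (Fin 3) ≃ₗᵢ[ℝ] EuclideanSpace ℝ (Fin 3), (∀ p ∈ P₀.points, dist p p₀ ≤ R → ∃ y ∈ P.points, dist y (x + A (p - p₀)) ≤ ε) ∧ (∀ y ∈ P.points, dist y x ≤ R → ∃ p ∈ P₀.points, dist y (x + A (p - p₀)) ≤ ε))
    (hC : ∀ P₀ : Literature.MathematicalPhysics.StatisticalMechanics.PeriodicConfiguration 3, IsLeast (Set.range fun Q : Literature.MathematicalPhysics.StatisticalMechanics.PeriodicConfiguration 3 => Q.energyPerParticle Literature.MathematicalPhysics.StatisticalMechanics.lennardJones) (P₀.energyPerParticle Literature.MathematicalPhysics.StatisticalMechanics.lennardJones) → ∃ r c : ℝ, 0 < r ∧ 0 < c ∧ ∀ P : Literature.MathematicalPhysics.StatisticalMechanics.PeriodicConfiguration 3, c * ({x : EuclideanSpace ℝ (Fin 3) | x ∈ P.motif ∧ ∃ z ∈ P.points, z ≠ x ∧ dist z x < r}.ncard : ℝ) ≤ (P.motif.card : ℝ) * (P.energyPerParticle Literature.MathematicalPhysics.StatisticalMechanics.lennardJones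 - P₀.energyPerParticle Literature.MathematicalPhysics.StatisticalMechanics.lennardJones)) :
    TorusDefectGap :=
  torusDefectGap_of_pieces' hE hT hL hC

end Summit.AtomisticToContinuum.Crystallization.Cruxes.TorusDefectGap.Split

end
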